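import Literature.RepresentationTheory.IrreducibleOddWeightsCertificate
import Literature.NumberTheory.ComplexMultiplication.CMTypeRankIrreducibleSlot
import Mathlib.LinearAlgebra.Dual.Lemmas
import HarnessLib

/-!
# Wedderburn certificates II: COVERING from the certificate; the full and the odd certificate

COR-CM (cell `pub-hodgecm2`, binder seat `b16` gen 58, count-neutral claim CERTIFICATES, file F2 — abstract finite-group
level; theorems only, no definition, no named fact, no `sorry`).  NEW as stated, hence under `Summits/`.  HONEST FRAMING:
finite-dimensional linear algebra over `ℚ` serving the census use of Mai's multiplicity formula
(`CorCM/IrreducibleOddWeightsMultiplicity*`); `HC_CM` is neither used nor asserted.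

F1 (`CorCM/IrreducibleOddWeightsCertificate`) derived from the CERTIFICATE — `Z_k`-linear `ℚ`-representations
`(π_k, V_k)` of a finite group `G` (`Z_k` division rings, `r_k = dim_{Z_k} V_k`, `d_k = dim_ℚ V_k`), a test space
`C ≤ ℚ^G` with (COUNT) `Σ_k r_k d_k ≤ dim C` and (FAITHFUL) `c ∈ C, Σ_g c(g)π_k(g) = 0 ∀k ⟹ c = 0` — that the `π_k` are
irreducible, pairwise disjoint, with `End_G V_k ≅ Z_k` (`δ_k r_k = d_k`).  This file adds the third hypothesis of Mai's
formula, COVERING, in exactly the shape consumed by `IrrOdd.finrank_orbitSpan_eq_sum` & Co.: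

* §1 **`exists_equivariant_apply_ne_zero_of_certificate`** — the engine: for ANY `ℚ`-representation `(σ, M)` of `G` and
  any non-zero `σ`-stable `P ≤ M` on which some `ε ∈ C` with `Σ_g ε(g)π_k(g) = 1 ∀k` acts as the identity, and such that
  the coefficient functions `g ↦ φ(σ(g⁻¹)p)` (`φ ∈ M^*`, `p ∈ P`) lie in `C`, some equivariant `T : M → V_k` does not kill
  `P`.  PROOF: the units `e_k ∈ C` of F1 have `Σ_k e_k = ε` (FAITHFUL), so `p = Σ_k e_k ⋆ p` and some `p₀ = e_{k₀} ⋆ p ≠ 0`;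
  if every equivariant `M → V_{k₀}` killed `P` then, averaging the rank-one maps `m ↦ φ(m) v`, `Σ_g φ(σ(g⁻¹)p₀) π_{k₀}(g) = 0`,
  while for `l ≠ k₀` the same operator is `(Σ_g e_{k₀}(g)π_l(g)) ∘ (…) = 0`; by FAITHFUL `g ↦ φ(σ(g⁻¹)p₀)` vanishes, so
  `φ(p₀) = 0` for every `φ`, `p₀ = 0`.
* §2 THE FULL CERTIFICATE (`C = ℚ^G`, `ε = δ_1`; COUNT `Σ_k r_k d_k ≤ |G|`): **`cover_of_certificate`** (any `(σ, M)`, any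
  stable `P ≠ 0`) and **`cover_perm_of_certificate`** (the permutation modules `ℚ^X`, `(g·f)(x) = f(g⁻¹x)`, verbatim the
  `hcov` hypothesis of the gen-57 files).
* §3 THE ODD CERTIFICATE — the PARITY REFINEMENT (`ρ ∈ G` with `ρ² = 1` — in the CM use the central complex
  conjugation —, only representations with `π_k(ρ) = −1`,
  `C = ℚ[G]⁻ = {c : c(ρg) = −c(g)}`, `ε = (δ_1 − δ_ρ)/2`; COUNT `Σ_k r_k d_k ≤ dim ℚ[G]⁻ = |G|/2`, FAITHFUL only for odd
  `c`): **`cover_of_oddCertificate`**, **`cover_perm_of_oddCertificate`** — covering of every stable `P` inside the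
  `ρ`-ODD part (where all the spans `U(Φ)`, `U(Σ)` of CM types live), with HALF the representations;
  `card_le_two_mul_finrank_antiWeights` (`|E| ≤ 2 dim Anti_ρ(E)` as soon as `E` carries a CM type for `ρ`) converts the
  count to `2 Σ_k r_k d_k ≤ |G|`.

## References

* [Serre1977] J.-P. Serre, *Linear Representations of Finite Groups*, GTM 42 (1977), §6.5 Prop. 16 and §12.2.
* [Mai1989] L. Mai, *Lower bounds for the ranks of CM types*, J. Number Theory 32 (1989), §2 Prop. 1.
* [Kubota1965] T. Kubota, *On the field extension by complex multiplication*, Trans. AMS 118 (1965), §2 (p. 115).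

Provenance: Literature home (namespace `Literature.RepresentationTheory.IrrOdd`) of the Summits-side `CorCM/IrreducibleOddWeightsCertificateCovering` (cell `pub-hodgecm2`, COR-CM; all its imports are `Literature/`, Mathlib and the already re-homed `IrreducibleOddWeightsCertificate`), which `Literature/` may not import; theorems only, no named fact, no definition. Nothing here bears on `HC_CM`. Lane `lit-hodgefound` (Layer A3: CM types, their Kubota ranks and Galois combinatorics), seat p20.
-/

set_option autoImplicit false

noncomputable section

open scoped BigOperators

universe u u' v w

namespace Literature.RepresentationTheory.IrrOdd

open Literature.NumberTheory.ComplexMultiplication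

variable {G : Type w} [Group G] [Fintype G]
variable {K : Type u'} [Fintype K]
variable {V : K → Type v} [∀ k, AddCommGroup (V k)] [∀ k, Module ℚ (V k)] [∀ k, FiniteDimensional ℚ (V k)]
variable {Z : K → Type u} [∀ k, DivisionRing (Z k)] [∀ k, Module (Z k) (V k)] [∀ k, Module.Finite (Z k) (V k)]
variable {M : Type*} [AddCommGroup M] [Module ℚ M]

/-! ### §0 The averaging gadget `m ↦ Σ_g φ(σ(g⁻¹) m) π(g)` -/

omit [Fintype K] [∀ k, FiniteDimensional ℚ (V k)] in
/-- Equivariance of `m ↦ Σ_g φ(σ(g⁻¹)m) π_l(g)`: replacing `m` by `σ(h)m` composes with `π_l(h)` on the left (reindex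
`g ↦ hg`). [cite: Serre1977, §6.5 Prop. 16 and §12.2] -/
theorem sum_dual_smul_apply_rep (π : ∀ k, Representation ℚ G (V k)) (σ : Representation ℚ G M) (l : K)
    (φ : Module.Dual ℚ M) (h : G) (m : M) (v : V l) :
    (∑ g, φ (σ g⁻¹ (σ h m)) • π l g) v = π l h ((∑ g, φ (σ g⁻¹ m) • π l g) v) := by
  rw [LinearMap.sum_apply, LinearMap.sum_apply, map_sum]
  conv_lhs => rw [← Equiv.sum_comp (Equiv.mulLeft h)]
  refine Finset.sum_congr rfl fun g _ => ?_
  rw [Equiv.coe_mulLeft, LinearMap.smul_apply, LinearMap.smul_apply, map_smul, map_mul, Module.End.mul_apply,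
    mul_inv_rev, map_mul, Module.End.mul_apply, ← Module.End.mul_apply (σ h⁻¹) (σ h), ← map_mul, inv_mul_cancel, map_one,
    Module.End.one_apply]

omit [Fintype K] [∀ k, FiniteDimensional ℚ (V k)] in
/-- `Σ_g δ_1(g) τ(g) = 1`. [cite: Serre1977, §6.5 Prop. 16 and §12.2] -/
theorem sum_single_one_smul_rep {N : Type*} [AddCommGroup N] [Module ℚ N] [DecidableEq G]
    (τ : Representation ℚ G N) : ∑ g, (Pi.single (1 : G) (1 : ℚ) : G → ℚ) g • τ g = LinearMap.id := by
  rw [Finset.sum_eq_single (1 : G) (fun g _ hg => by rw [Pi.single_eq_of_ne hg, zero_smul])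
    (fun h => absurd (Finset.mem_univ _) h), Pi.single_eq_same, one_smul, map_one]
  rfl

omit [Fintype K] [∀ k, FiniteDimensional ℚ (V k)] in
/-- `Σ_g ½(δ_1 − δ_ρ)(g) τ(g) n = n` when `τ(ρ) n = −n`. [cite: Serre1977, §6.5 Prop. 16 and §12.2] -/
theorem sum_halfDiff_smul_rep_apply {N : Type*} [AddCommGroup N] [Module ℚ N] [DecidableEq G]
    (τ : Representation ℚ G N) (ρ : G) (n : N) (hn : τ ρ n = -n) :
    ∑ g, ((1 / 2 : ℚ) • (Pi.single (1 : G) (1 : ℚ) - Pi.single ρ (1 : ℚ)) : G → ℚ) g • τ g n = n := by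
  have h1 : ∀ a : G, ∑ g, (Pi.single a (1 : ℚ) : G → ℚ) g • τ g n = τ a n := fun a => by
    rw [Finset.sum_eq_single a (fun g _ hg => by rw [Pi.single_eq_of_ne hg, zero_smul])
      (fun h => absurd (Finset.mem_univ a) h), Pi.single_eq_same, one_smul]
  have hrw : ∀ g : G, ((1 / 2 : ℚ) • (Pi.single (1 : G) (1 : ℚ) - Pi.single ρ (1 : ℚ)) : G → ℚ) g • τ g n =
      (1 / 2 : ℚ) • ((Pi.single (1 : G) (1 : ℚ) : G → ℚ) g • τ g n) -
        (1 / 2 : ℚ) • ((Pi.single ρ (1 : ℚ) : G → ℚ) g • τ g n) := fun g => by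
    rw [Pi.smul_apply, Pi.sub_apply, smul_eq_mul, mul_sub, sub_smul, mul_smul, mul_smul]
  rw [Finset.sum_congr rfl fun g _ => hrw g, Finset.sum_sub_distrib, ← Finset.smul_sum, ← Finset.smul_sum, h1, h1,
    map_one, Module.End.one_apply, hn, smul_neg, sub_neg_eq_add, ← add_smul]
  norm_num

/-! ### §1 The engine: covering from the certificate -/

/-- **COVERING FROM THE CERTIFICATE (engine).**  Under the certificate of F1 (`Z_k`-linear `π_k`, test space `C`, COUNT,
FAITHFUL): let `(σ, M)` be any `ℚ`-representation of `G`, `P ≤ M` a non-zero `σ`-stable subspace, `ε ∈ C` with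
`Σ_g ε(g)π_k(g) = 1` for all `k` and `Σ_g ε(g)σ(g)p = p` on `P`, and suppose the coefficient functions `g ↦ φ(σ(g⁻¹)p)`
(`φ ∈ M^*`, `p ∈ P`) lie in `C`.  Then some equivariant `T : M → V_k` does not vanish on `P`.
[cite: Serre1977, §6.5 Prop. 16 and §12.2] -/
theorem exists_equivariant_apply_ne_zero_of_certificate (π : ∀ k, Representation ℚ G (V k))
    (hlin : ∀ k (g : G) (z : Z k) (v : V k), π k g (z • v) = z • π k g v) (C : Submodule ℚ (G → ℚ))
    (hcount : ∑ k, Module.finrank (Z k) (V k) * Module.finrank ℚ (V k) ≤ Module.finrank ℚ C)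
    (hfaith : ∀ c ∈ C, (∀ k, ∑ g, c g • π k g = 0) → c = 0) (σ : Representation ℚ G M)
    (ε : G → ℚ) (hεC : ε ∈ C) (hε : ∀ k, ∑ g, ε g • π k g = LinearMap.id)
    (P : Submodule ℚ M) (hPst : ∀ (g : G) (m : M), m ∈ P → σ g m ∈ P) (hεP : ∀ p ∈ P, ∑ g, ε g • σ g p = p)
    (hCP : ∀ (φ : Module.Dual ℚ M) (p : M), p ∈ P → (fun g => φ (σ g⁻¹ p)) ∈ C) (hP : P ≠ ⊥) :
    ∃ k, ∃ T : M →ₗ[ℚ] V k, (∀ (g : G) (m : M), T (σ g m) = π k g (T m)) ∧ ∃ p ∈ P, T p ≠ 0 := by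
  classical
  by_contra H
  push Not at H
  obtain ⟨p, hpP, hp0⟩ := Submodule.exists_mem_ne_zero_of_ne_bot hP
  -- the units of F1
  choose e heC he1 he0 using fun k => exists_mem_sum_smul_eq_single π hlin C hcount hfaith k
  -- `Σ_k e_k = ε` by FAITHFUL
  have hsum : ∑ k, e k = ε := by
    have hmem : (∑ k, e k) - ε ∈ C := C.sub_mem (C.sum_mem fun k _ => heC k) hεC
    have h0 := hfaith _ hmem fun l => by
      have : ∑ g, (∑ k, e k) g • π l g = ∑ k, ∑ g, e k g • π l g := by
        rw [Finset.sum_comm]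
        refine Finset.sum_congr rfl fun g _ => ?_
        rw [Finset.sum_apply, Finset.sum_smul]
      simp only [Pi.sub_apply, sub_smul, Finset.sum_sub_distrib, this, hε l]
      rw [Finset.sum_eq_single l (fun k _ hk => he0 k l (Ne.symm hk)) (fun h => absurd (Finset.mem_univ l) h), he1,
        sub_self]
    exact sub_eq_zero.1 h0
  -- `p = Σ_k p_k`, `p_k = Σ_g e_k(g) σ(g) p`; one `p_{k₀} ≠ 0`
  have hp : ∑ k, ∑ g, e k g • σ g p = p := by
    calc ∑ k, ∑ g, e k g • σ g p = ∑ g, (∑ k, e k) g • σ g p := by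
          rw [Finset.sum_comm]
          refine Finset.sum_congr rfl fun g _ => ?_
          rw [Finset.sum_apply, Finset.sum_smul]
      _ = p := by rw [hsum]; exact hεP p hpP
  have hne : ∑ k, ∑ g, e k g • σ g p ≠ 0 := by rwa [hp]
  obtain ⟨k₀, -, hk₀⟩ := Finset.exists_ne_zero_of_sum_ne_zero hne
  set p₀ : M := ∑ g, e k₀ g • σ g p with hp₀
  have hp₀P : p₀ ∈ P := P.sum_mem fun g _ => P.smul_mem _ (hPst g p hpP)
  -- for every `φ ∈ M^*` the coefficient function `g ↦ φ(σ(g⁻¹)p₀)` vanishes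
  have hzero : ∀ φ : Module.Dual ℚ M, (fun g => φ (σ g⁻¹ p₀)) = 0 := by
    intro φ
    refine hfaith _ (hCP φ p₀ hp₀P) fun l => ?_
    by_cases hl : l = k₀
    · subst hl
      -- at `k₀`: the averaged rank-one maps `m ↦ Σ_g φ(σ(g⁻¹)m) π(g) v` are equivariant, hence kill `p₀`
      ext v
      let T : M →ₗ[ℚ] V l := LinearMap.applyₗ v ∘ₗ ∑ g, (φ ∘ₗ σ g⁻¹).smulRight (π l g)
      have hT : ∀ m, T m = (∑ g, φ (σ g⁻¹ m) • π l g) v := fun m => by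
        simp only [T, LinearMap.comp_apply, LinearMap.applyₗ_apply_apply, LinearMap.sum_apply,
          LinearMap.smulRight_apply, LinearMap.smul_apply]
      have hTeq : ∀ (g : G) (m : M), T (σ g m) = π l g (T m) := fun g m => by
        rw [hT, hT, sum_dual_smul_apply_rep π σ l φ g m v]
      have := H l T hTeq p₀ hp₀P
      rw [hT] at this
      rw [this, LinearMap.zero_apply]
    · -- at `l ≠ k₀`: `Σ_g φ(σ(g⁻¹)p₀) π_l(g) = (Σ_h e_{k₀}(h) π_l(h)) ∘ (Σ_g φ(σ(g⁻¹)p) π_l(g)) = 0`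
      ext v
      have hexp : (∑ g, φ (σ g⁻¹ p₀) • π l g) v =
          (∑ h, e k₀ h • π l h) ((∑ g, φ (σ g⁻¹ p) • π l g) v) := by
        have hlinear : ∀ m, (∑ g, φ (σ g⁻¹ m) • π l g) v =
            (LinearMap.applyₗ v ∘ₗ ∑ g, (φ ∘ₗ σ g⁻¹).smulRight (π l g)) m := fun m => by
          simp only [LinearMap.comp_apply, LinearMap.applyₗ_apply_apply, LinearMap.sum_apply,
            LinearMap.smulRight_apply, LinearMap.smul_apply]
        rw [hlinear, hp₀, map_sum, LinearMap.sum_apply]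
        refine Finset.sum_congr rfl fun h _ => ?_
        rw [map_smul, LinearMap.smul_apply, ← hlinear, sum_dual_smul_apply_rep π σ l φ h p v]
      rw [hexp, he0 k₀ l hl, LinearMap.zero_apply, LinearMap.zero_apply]
  -- hence `φ(p₀) = 0` for all `φ`, so `p₀ = 0`
  apply hk₀
  rw [← Module.forall_dual_apply_eq_zero_iff ℚ p₀]
  intro φ
  have := congrFun (hzero φ) 1
  simpa using this

/-! ### §2 The full certificate (`C = ℚ^G`) -/

/-- **COVERING FROM THE FULL CERTIFICATE.**  `Z_k`-linear `π_k` with `Σ_k r_k d_k ≤ |G|` and `ℚ^G` faithful on `⊕_k V_k`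
(`Σ_g c(g)π_k(g) = 0 ∀k ⟹ c = 0`): every non-zero stable subspace of every `ℚ`-representation `(σ, M)` of `G` is met by an
equivariant map to some `V_k`. [cite: Serre1977, §6.5 Prop. 16 and §12.2] -/
theorem cover_of_certificate (π : ∀ k, Representation ℚ G (V k))
    (hlin : ∀ k (g : G) (z : Z k) (v : V k), π k g (z • v) = z • π k g v)
    (hcount : ∑ k, Module.finrank (Z k) (V k) * Module.finrank ℚ (V k) ≤ Fintype.card G)
    (hfaith : ∀ c : G → ℚ, (∀ k, ∑ g, c g • π k g = 0) → c = 0) (σ : Representation ℚ G M)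
    (P : Submodule ℚ M) (hP : P ≠ ⊥) (hPst : ∀ (g : G) (m : M), m ∈ P → σ g m ∈ P) :
    ∃ k, ∃ T : M →ₗ[ℚ] V k, (∀ (g : G) (m : M), T (σ g m) = π k g (T m)) ∧ ∃ p ∈ P, T p ≠ 0 := by
  classical
  have hcount' : ∑ k, Module.finrank (Z k) (V k) * Module.finrank ℚ (V k) ≤
      Module.finrank ℚ (⊤ : Submodule ℚ (G → ℚ)) := by
    rwa [finrank_top, Module.finrank_fintype_fun_eq_card]
  exact exists_equivariant_apply_ne_zero_of_certificate π hlin ⊤ hcount' (fun c _ hc => hfaith c hc) σ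
    (Pi.single 1 1) Submodule.mem_top (fun k => sum_single_one_smul_rep (π k)) P hPst
    (fun p _ => by
      have h := LinearMap.congr_fun (sum_single_one_smul_rep σ) p
      simpa only [LinearMap.sum_apply, LinearMap.smul_apply, LinearMap.id_apply] using h)
    (fun _ _ _ => Submodule.mem_top) hP

/-- **COVERING OF THE PERMUTATION MODULES from the full certificate** — verbatim the hypothesis `hcov` of
`IrrOdd.finrank_orbitSpan_eq_sum` / `finrank_antiSpan_sigmaType_eq_sum` / the criteria of gen 57: every non-zero stable
`P ≤ ℚ^X` (`(g·f)(x) = f(g⁻¹x)`, any `G`-set `X`) is met by an equivariant `T : ℚ^X → V_k`.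
[cite: Serre1977, §6.5 Prop. 16 and §12.2] [cite: Mai1989, §2 Prop. 1] -/
theorem cover_perm_of_certificate {X : Type*} [MulAction G X] (π : ∀ k, Representation ℚ G (V k))
    (hlin : ∀ k (g : G) (z : Z k) (v : V k), π k g (z • v) = z • π k g v)
    (hcount : ∑ k, Module.finrank (Z k) (V k) * Module.finrank ℚ (V k) ≤ Fintype.card G)
    (hfaith : ∀ c : G → ℚ, (∀ k, ∑ g, c g • π k g = 0) → c = 0)
    (P : Submodule ℚ (X → ℚ)) (hP : P ≠ ⊥) (hPst : ∀ (g : G) (f : X → ℚ), f ∈ P → (fun x => f (g • x)) ∈ P) :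
    ∃ k, ∃ T : (X → ℚ) →ₗ[ℚ] V k,
      (∀ (g : G) (f : X → ℚ), T (fun x => f (g⁻¹ • x)) = π k g (T f)) ∧ ∃ f ∈ P, T f ≠ 0 := by
  let σ : Representation ℚ G (X → ℚ) :=
    { toFun := fun g => LinearMap.funLeft ℚ ℚ fun x : X => g⁻¹ • x
      map_one' := by ext f x; simp
      map_mul' := fun g h => by ext f x; simp [mul_smul] }
  obtain ⟨k, T, hT, hTP⟩ := cover_of_certificate π hlin hcount hfaith σ P hP fun g f hf => hPst g⁻¹ f hf
  exact ⟨k, T, fun g f => hT g f, hTP⟩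

/-! ### §3 The odd certificate: the parity refinement -/

omit [Fintype G] [Fintype K] [∀ k, FiniteDimensional ℚ (V k)] in
/-- For `ρ² = 1` and `p` in the `ρ`-odd part, the coefficient functions `g ↦ φ(σ(g⁻¹)p)` are odd.
[cite: Kubota1965, §2 (p. 115)] -/
theorem dual_rep_inv_odd (σ : Representation ℚ G M) {ρ : G} (hρ2 : ρ * ρ = 1)
    (φ : Module.Dual ℚ M) {p : M} (hp : σ ρ p = -p) (g : G) : φ (σ (ρ * g)⁻¹ p) = -φ (σ g⁻¹ p) := by
  have hρinv : ρ⁻¹ = ρ := inv_eq_of_mul_eq_one_right hρ2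
  rw [mul_inv_rev, hρinv, map_mul, Module.End.mul_apply, hp, map_neg, map_neg]

/-- **COVERING FROM THE ODD CERTIFICATE (parity refinement).**  `ρ ∈ G` with `ρ² = 1`; `Z_k`-linear `π_k` on
which `ρ` acts as `−1`; COUNT `Σ_k r_k d_k ≤ dim ℚ[G]⁻` (`ℚ[G]⁻ = Anti_ρ(G)`, the `ρ`-odd functions, of dimension
`|G|/2`); FAITHFUL only for ODD `c`.  Then every non-zero stable subspace of the `ρ`-odd part (`σ(ρ) = −1` on it) of any
`ℚ`-representation `(σ, M)` is met by an equivariant map to some `V_k` — the even representations are never needed for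
the spans of CM types. [cite: Serre1977, §6.5 Prop. 16 and §12.2] [cite: Kubota1965, §2 (p. 115)] -/
theorem cover_of_oddCertificate (π : ∀ k, Representation ℚ G (V k))
    (hlin : ∀ k (g : G) (z : Z k) (v : V k), π k g (z • v) = z • π k g v) {ρ : G}
    (hρ2 : ρ * ρ = 1) (hodd : ∀ k (v : V k), π k ρ v = -v)
    (hcount : ∑ k, Module.finrank (Z k) (V k) * Module.finrank ℚ (V k) ≤
      Module.finrank ℚ (antiWeights (E := G) ρ))
    (hfaith : ∀ c : G → ℚ, (∀ g, c (ρ * g) = -c g) → (∀ k, ∑ g, c g • π k g = 0) → c = 0)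
    (σ : Representation ℚ G M) (P : Submodule ℚ M) (hP : P ≠ ⊥) (hPst : ∀ (g : G) (m : M), m ∈ P → σ g m ∈ P)
    (hPodd : ∀ p ∈ P, σ ρ p = -p) :
    ∃ k, ∃ T : M →ₗ[ℚ] V k, (∀ (g : G) (m : M), T (σ g m) = π k g (T m)) ∧ ∃ p ∈ P, T p ≠ 0 := by
  classical
  have hρinv : ρ⁻¹ = ρ := inv_eq_of_mul_eq_one_right hρ2
  have hmem : ∀ c : G → ℚ, c ∈ antiWeights (E := G) ρ ↔ ∀ g, c (ρ * g) = -c g := fun c => mem_antiWeights_iff'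
  -- `ε = (δ_1 − δ_ρ)/2` is odd
  have hεC : ((1 / 2 : ℚ) • (Pi.single (1 : G) (1 : ℚ) - Pi.single ρ (1 : ℚ)) : G → ℚ) ∈ antiWeights (E := G) ρ := by
    rw [hmem]
    intro g
    have e1 : ρ * g = 1 ↔ g = ρ := by rw [mul_eq_one_iff_inv_eq, hρinv, eq_comm]
    have e2 : ρ * g = ρ ↔ g = 1 :=
      ⟨fun h => mul_left_cancel (h.trans (mul_one ρ).symm), fun h => by rw [h, mul_one]⟩
    simp only [Pi.smul_apply, Pi.sub_apply, Pi.single_apply, e1, e2, smul_eq_mul]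
    ring
  exact exists_equivariant_apply_ne_zero_of_certificate π hlin (antiWeights (E := G) ρ) hcount
    (fun c hc h0 => hfaith c ((hmem c).1 hc) h0) σ _ hεC
    (fun k => by
      ext v
      rw [LinearMap.sum_apply, LinearMap.id_apply]
      simp only [LinearMap.smul_apply]
      exact sum_halfDiff_smul_rep_apply (π k) ρ v (hodd k v))
    P hPst (fun p hp => sum_halfDiff_smul_rep_apply σ ρ p (hPodd p hp))
    (fun φ p hp => (hmem _).2 fun g => dual_rep_inv_odd σ hρ2 φ (hPodd p hp) g) hP

/-- **COVERING OF THE ODD PARTS OF THE PERMUTATION MODULES from the odd certificate** — the hypothesis `hcov` of the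
gen-57 files for every `P ≤ Anti_ρ(X)` (e.g. `P ≤ U(Φ)`, `P ≤ U(Σ)` for CM types `Φ`, `Σ` with conjugation `ρ`), from odd
representations only. [cite: Serre1977, §6.5 Prop. 16 and §12.2] [cite: Kubota1965, §2 (p. 115)] -/
theorem cover_perm_of_oddCertificate {X : Type*} [MulAction G X] (π : ∀ k, Representation ℚ G (V k))
    (hlin : ∀ k (g : G) (z : Z k) (v : V k), π k g (z • v) = z • π k g v) {ρ : G}
    (hρ2 : ρ * ρ = 1) (hodd : ∀ k (v : V k), π k ρ v = -v)
    (hcount : ∑ k, Module.finrank (Z k) (V k) * Module.finrank ℚ (V k) ≤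
      Module.finrank ℚ (antiWeights (E := G) ρ))
    (hfaith : ∀ c : G → ℚ, (∀ g, c (ρ * g) = -c g) → (∀ k, ∑ g, c g • π k g = 0) → c = 0)
    (P : Submodule ℚ (X → ℚ)) (hP : P ≠ ⊥) (hPst : ∀ (g : G) (f : X → ℚ), f ∈ P → (fun x => f (g • x)) ∈ P)
    (hPodd : P ≤ antiWeights (E := X) ρ) :
    ∃ k, ∃ T : (X → ℚ) →ₗ[ℚ] V k,
      (∀ (g : G) (f : X → ℚ), T (fun x => f (g⁻¹ • x)) = π k g (T f)) ∧ ∃ f ∈ P, T f ≠ 0 := by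
  have hρinv : ρ⁻¹ = ρ := inv_eq_of_mul_eq_one_right hρ2
  let σ : Representation ℚ G (X → ℚ) :=
    { toFun := fun g => LinearMap.funLeft ℚ ℚ fun x : X => g⁻¹ • x
      map_one' := by ext f x; simp
      map_mul' := fun g h => by ext f x; simp [mul_smul] }
  obtain ⟨k, T, hT, hTP⟩ := cover_of_oddCertificate π hlin hρ2 hodd hcount hfaith σ P hP
    (fun g f hf => hPst g⁻¹ f hf) fun f hf => by
      funext x
      change f (ρ⁻¹ • x) = -f x
      rw [hρinv]
      exact mem_antiWeights_iff'.1 (hPodd hf) x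
  exact ⟨k, T, fun g f => hT g f, hTP⟩

/-! ### §4 The odd count: `|E| ≤ 2 · dim Anti_ρ(E)` -/

omit [Fintype G] in
/-- **`|E| ≤ 2 · dim Anti_ρ(E)`** when `E` carries a CM type `Φ` for `ρ`: the `|Φ| = |E|/2` odd vectors `δ_x − δ_{ρx}`
(`x ∈ Φ`) are linearly independent.  (With `CorCM/ParallelShadowsCapacity.finrank_antiWeights_le`: equality.)  Converts
the odd COUNT `2 Σ_k r_k d_k ≤ |G|` into `Σ_k r_k d_k ≤ dim ℚ[G]⁻`. [cite: Kubota1965, §2 (p. 115)] -/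
theorem card_le_two_mul_finrank_antiWeights {E : Type*} [MulAction G E] [Fintype E] [DecidableEq E] {ρ : G}
    {Φ : Set E} (h : IsCMTypeWith ρ Φ) : Fintype.card E ≤ 2 * Module.finrank ℚ (antiWeights (E := E) ρ) := by
  classical
  -- `2 |Φ| = |E|`
  set s : Finset E := Finset.univ.filter fun x : E => x ∈ Φ with hs
  have hcard : 2 * s.card = Fintype.card E := by
    have himage : s.image (fun x => ρ • x) = Finset.univ.filter fun x : E => x ∉ Φ := by
      ext x
      simp only [hs, Finset.mem_image, Finset.mem_filter, Finset.mem_univ, true_and]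
      constructor
      · rintro ⟨y, hy, rfl⟩
        exact (h.mem_iff y).1 hy
      · intro hx
        exact ⟨ρ • x, (h.rho_smul_mem_iff x).2 hx, h.invol x⟩
    have hinj : Set.InjOn (fun x : E => ρ • x) ↑s := fun a _ b _ hab => by
      simpa [h.invol] using congrArg (fun t => ρ • t) hab
    have h1 := Finset.card_image_of_injOn hinj
    rw [himage] at h1
    have h2 := Finset.card_filter_add_card_filter_not (s := (Finset.univ : Finset E)) (fun x : E => x ∈ Φ)
    rw [Finset.card_univ, ← hs] at h2
    omega
  -- the odd vectors `δ_x − δ_{ρx}`, `x ∈ Φ`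
  have hmemA : ∀ x : E, (Pi.single x (1 : ℚ) - Pi.single (ρ • x) (1 : ℚ) : E → ℚ) ∈ antiWeights (E := E) ρ := by
    intro x
    rw [mem_antiWeights_iff']
    intro y
    have e1 : ρ • y = x ↔ y = ρ • x := by
      constructor
      · intro hy; rw [← hy, h.invol]
      · intro hy; rw [hy, h.invol]
    have e2 : ρ • y = ρ • x ↔ y = x := by
      constructor
      · intro hy; simpa [h.invol] using congrArg (fun t => ρ • t) hy
      · intro hy; rw [hy]
    simp only [Pi.sub_apply, Pi.single_apply, e1, e2, neg_sub]
  let u : ↥s → antiWeights (E := E) ρ := fun x => ⟨Pi.single (x : E) (1 : ℚ) - Pi.single (ρ • (x : E)) 1, hmemA x⟩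
  have hli : LinearIndependent ℚ u := by
    apply LinearIndependent.of_comp (antiWeights (E := E) ρ).subtype
    rw [Fintype.linearIndependent_iff]
    intro c hc y
    have hy : (y : E) ∈ Φ := (Finset.mem_filter.1 y.2).2
    have heval := congrFun hc (y : E)
    simp only [Function.comp_apply, Submodule.coe_subtype, Finset.sum_apply, Pi.smul_apply, Pi.sub_apply,
      Pi.single_apply, smul_eq_mul, Pi.zero_apply, u] at heval
    rw [Finset.sum_eq_single y (fun x _ hxy => ?_) (fun hh => absurd (Finset.mem_univ y) hh)] at heval
    · have hne : (y : E) ≠ ρ • (y : E) := fun hh => (h.rho_smul_ne (y : E)) hh.symm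
      simpa [hne] using heval
    · have hx : (x : E) ∈ Φ := (Finset.mem_filter.1 x.2).2
      have hne1 : (y : E) ≠ (x : E) := fun hh => hxy (Subtype.ext hh.symm)
      have hne2 : (y : E) ≠ ρ • (x : E) := fun hh => (h.rho_smul_mem_iff (x : E)).not.2 (not_not.2 hx) (hh ▸ hy)
      simp [hne1, hne2]
  have hle := hli.fintype_card_le_finrank
  rw [Fintype.card_coe] at hle
  calc Fintype.card E = 2 * s.card := hcard.symm
    _ ≤ 2 * Module.finrank ℚ (antiWeights (E := E) ρ) := Nat.mul_le_mul_left 2 hle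

end Literature.RepresentationTheory.IrrOdd

end
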